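import Literature.MathematicalPhysics.QuantumLattice.DWaveSourceProofs
import Literature.MathematicalPhysics.QuantumLattice.LiebFluxPhaseProofs
import Literature.MathematicalPhysics.QuantumLattice.SectorSpectrum
import Literature.MathematicalPhysics.QuantumLattice.HubbardWave0RepulsiveProofs
import Literature.MathematicalPhysics.QuantumLattice.PairFieldMomentum
import Literature.MathematicalPhysics.QuantumLattice.HubbardModelSpinProofs
import Literature.MathematicalPhysics.QuantumLattice.PairChirality

/-!
# Crux `TwSeededEnsembleEquivalence` (stmt-HubbardSuperconductivity-1698), line `exposed-density-duality` — stub `stub_evenSectorMin`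

If the pair field is a spin singlet then, for even `N ≤ 2L²`, the `S^z = 0` sector realises the `N`-sector minimum of the seeded canonical Hamiltonian `Hcan = hubbardTorus 2 L 1 U − (g/L²)Δ_dᴴΔ_d` (the `N`-sector ground eigenspace is stable under `S^±`, decomposes into integer `S^z`-weights, hence meets `S^z = 0`: `IsSu2Triple.su2_multiplet` (1)).
-/

namespace Summit.HubbardSuperconductivity.HubbardSuperconductivity.Theorems.TwSeededEnsembleEquivalence.ExposedDensity

open Matrix Filter Topology Literature.MathematicalPhysics.QuantumLattice
open scoped ComplexOrder Matrix.Norms.L2Operator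

noncomputable section

section Helpers

variable {Λ : Type*} [LinearOrder Λ] [Fintype Λ]

/-- Weight decomposition of an eigen-sector of a `(N↑, N↓)`-block-diagonal matrix `A`: a
`2n`-particle eigenvector of `A` is the sum of its restrictions to the `S^z = m` sectors, each again
an eigenvector in the `2n`-particle sector (adapted from `LiebTwo.groundSector_weight_decomposition`,
with `preservesSectors_hamiltonian` replaced by the hypothesis `PreservesSectors A`). [folklore] -/
-- adapted from `LiebTwo.groundSector_weight_decomposition` (Literature/MathematicalPhysics/QuantumLattice/HubbardWave0RepulsiveProofs.lean)
private theorem weight_decomposition_of_preservesSectors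
    {A : Matrix (Finset (Orb Λ)) (Finset (Orb Λ)) ℂ} (hA : PreservesSectors A) (n : ℕ) (E : ℝ)
    {ψ : Fock (Orb Λ)} (hψ : A *ᵥ ψ = (E : ℂ) • ψ ∧ IsNParticle (2 * n) ψ) :
    ∃ (S : Finset ℤ) (w : ℤ → Fock (Orb Λ)),
      (∀ m ∈ S, (A *ᵥ w m = (E : ℂ) • w m ∧ IsNParticle (2 * n) (w m)) ∧
        HubbardWave0.spinZ *ᵥ w m = (m : ℂ) • w m) ∧ ψ = ∑ m ∈ S, w m := by
  classical
  set wt : Finset (Orb Λ) → ℤ := fun s => ((upPart s).card : ℤ) - (downPart s).card with hwt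
  set w : ℤ → Fock (Orb Λ) := fun m s => if wt s = 2 * m then ψ s else 0 with hw
  have hwt_eq : ∀ {s s' : Finset (Orb Λ)}, A s s' ≠ 0 → wt s = wt s' := by
    intro s s' h
    obtain ⟨h1, h2⟩ := hA _ _ h
    simp only [hwt, h1, h2]
  refine ⟨Finset.Icc (-(n : ℤ)) n, w, fun m _ => ⟨⟨?_, ?_⟩, ?_⟩, ?_⟩
  · -- eigenvector
    funext s
    simp only [Pi.smul_apply, smul_eq_mul, mulVec, dotProduct]
    have hterm : ∀ s', A s s' * w m s' = if wt s = 2 * m then A s s' * ψ s' else 0 := by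
      intro s'
      simp only [hw]
      by_cases hH : A s s' = 0
      · simp [hH]
      · rw [hwt_eq hH]
        split_ifs <;> simp
    rw [Finset.sum_congr rfl fun s' _ => hterm s']
    simp only [hw]
    split_ifs with hs
    · have := congrFun hψ.1 s
      simp only [mulVec, dotProduct, Pi.smul_apply, smul_eq_mul] at this
      exact this
    · rw [Finset.sum_const_zero, mul_zero]
  · -- `2n`-particle
    intro s hs
    simp only [hw]
    split_ifs
    · exact hψ.2 s hs
    · rfl
  · -- weight
    funext s
    rw [LiebThm1.spinZ_mulVec_apply, Pi.smul_apply, smul_eq_mul]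
    simp only [hw]
    split_ifs with hs
    · have hc : (((upPart s).card : ℂ) - (downPart s).card) = ((wt s : ℤ) : ℂ) := by simp [hwt]
      rw [hc, hs]; push_cast; ring
    · simp
  · -- completeness
    funext s
    rw [Finset.sum_apply]
    by_cases hψs : ψ s = 0
    · rw [hψs]; symm
      refine Finset.sum_eq_zero fun m _ => ?_
      simp only [hw]; split_ifs <;> simp [hψs]
    · have hcard : s.card = 2 * n := by by_contra h; exact hψs (hψ.2 s h)
      have hsum : (upPart s).card + (downPart s).card = 2 * n := by
        rw [← card_pairSet, pairSet_upPart_downPart, hcard]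
      set m₀ : ℤ := ((upPart s).card : ℤ) - n with hm₀
      have hwt₀ : wt s = 2 * m₀ := by
        simp only [hwt, hm₀]
        have : ((downPart s).card : ℤ) = 2 * n - (upPart s).card := by omega
        rw [this]; ring
      rw [Finset.sum_eq_single m₀]
      · simp only [hw]; rw [if_pos hwt₀]
      · intro m _ hm
        simp only [hw]; rw [if_neg]; rw [hwt₀]; omega
      · intro hm
        exfalso; apply hm
        rw [Finset.mem_Icc, hm₀]
        constructor <;> omega

end Helpers

section Seed

variable (L : ℕ) [NeZero L] (U g : ℝ)

/-- `Δ_dᴴ Δ_d` conserves `N↑` and `N↓` (`Δ_d` has `(N↑, N↓)`-grade `(-1, -1)`). [folklore] -/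
private theorem preservesSectors_seed :
    PreservesSectors ((pairField dWaveFormFactor L)ᴴ * pairField dWaveFormFactor L) := by
  have hP : PairChirality.Shifts (-1) (-1) (pairField dWaveFormFactor L) :=
    PairChirality.Shifts.sum fun x _ => PairChirality.shifts_localPair L dWaveFormFactor x
  have h := hP.conjTranspose.mul hP
  simp only [Int.reduceNeg, neg_neg, add_neg_cancel] at h
  exact h.preservesSectors

/-- The seeded canonical Hamiltonian conserves `N↑` and `N↓`. [folklore] -/
private theorem preservesSectors_hcan :
    PreservesSectors (hubbardTorus 2 L 1 U - ((g / (L : ℝ) ^ 2 : ℝ) : ℂ) •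
        ((pairField dWaveFormFactor L)ᴴ * pairField dWaveFormFactor L)) := by
  intro s s' hst
  have hH := LiebThm1.preservesSectors_hamiltonian (fermionTorusGraph 2 L) 1 U
  have hP := preservesSectors_seed L
  rw [hubbardTorus, Matrix.sub_apply, Matrix.smul_apply, smul_eq_mul] at hst
  by_cases h1 : hamiltonian (fermionTorusGraph 2 L) 1 U s s' = 0
  · rw [h1, zero_sub, neg_ne_zero] at hst
    exact hP s s' (right_ne_zero_of_mul hst)
  · exact hH s s' h1

/-- The seeded canonical Hamiltonian is Hermitian (real seed coefficient). [folklore] -/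
private theorem isHermitian_hcan :
    (hubbardTorus 2 L 1 U - ((g / (L : ℝ) ^ 2 : ℝ) : ℂ) •
        ((pairField dWaveFormFactor L)ᴴ * pairField dWaveFormFactor L)).IsHermitian := by
  have h := isHermitian_hubbardTorusWith L 1 U 0
  rw [hubbardTorusWith_zero] at h
  exact h.sub ((pairField_conjTranspose_mul_self_posSemidef dWaveFormFactor L).isHermitian.smul
    (by rw [isSelfAdjoint_iff, Complex.star_def, Complex.conj_ofReal]))

/-- If `Δ_d` commutes with `S^±` then so does `Δ_dᴴ Δ_d` (`S⁻ = (S⁺)ᴴ`): the `S⁺` case. [folklore] -/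
private theorem commute_seed_spinPlus
    (h : Commute (pairField dWaveFormFactor L) spinPlus ∧
      Commute (pairField dWaveFormFactor L) spinMinus) :
    Commute ((pairField dWaveFormFactor L)ᴴ * pairField dWaveFormFactor L) spinPlus := by
  have h2 : Commute (pairField dWaveFormFactor L)ᴴ spinPlus := by
    have h' := congrArg conjTranspose h.2.eq
    rw [conjTranspose_mul, conjTranspose_mul] at h'
    have hm : (spinMinus : Matrix (Finset (Orb (FermionTorus 2 L))) _ ℂ)ᴴ = spinPlus := by
      rw [spinMinus, conjTranspose_conjTranspose]
    rw [hm] at h'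
    exact h'.symm
  exact h2.mul_left h.1

/-- If `Δ_d` commutes with `S^±` then so does `Δ_dᴴ Δ_d`: the `S⁻` case. [folklore] -/
private theorem commute_seed_spinMinus
    (h : Commute (pairField dWaveFormFactor L) spinPlus ∧
      Commute (pairField dWaveFormFactor L) spinMinus) :
    Commute ((pairField dWaveFormFactor L)ᴴ * pairField dWaveFormFactor L) spinMinus := by
  have h2 : Commute (pairField dWaveFormFactor L)ᴴ spinMinus := by
    have h' := congrArg conjTranspose h.1.eq
    rw [conjTranspose_mul, conjTranspose_mul] at h'
    have hm : (spinPlus : Matrix (Finset (Orb (FermionTorus 2 L))) _ ℂ)ᴴ = spinMinus := rfl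
    rw [hm] at h'
    exact h'.symm
  exact h2.mul_left h.2

/-- The seeded canonical Hamiltonian commutes with `S⁺` (given the singlet property of `Δ_d`). [folklore] -/
private theorem commute_hcan_spinPlus
    (h : Commute (pairField dWaveFormFactor L) spinPlus ∧
      Commute (pairField dWaveFormFactor L) spinMinus) :
    Commute (hubbardTorus 2 L 1 U - ((g / (L : ℝ) ^ 2 : ℝ) : ℂ) •
        ((pairField dWaveFormFactor L)ᴴ * pairField dWaveFormFactor L)) spinPlus :=
  (LiebThm1.hamiltonian_commute_spinPlus (fermionTorusGraph 2 L) 1 U).sub_left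
    ((commute_seed_spinPlus L h).smul_left _)

/-- The seeded canonical Hamiltonian commutes with `S⁻` (given the singlet property of `Δ_d`). [folklore] -/
private theorem commute_hcan_spinMinus
    (h : Commute (pairField dWaveFormFactor L) spinPlus ∧
      Commute (pairField dWaveFormFactor L) spinMinus) :
    Commute (hubbardTorus 2 L 1 U - ((g / (L : ℝ) ^ 2 : ℝ) : ℂ) •
        ((pairField dWaveFormFactor L)ᴴ * pairField dWaveFormFactor L)) spinMinus :=
  (LiebThm1.hamiltonian_commute_spinMinus (fermionTorusGraph 2 L) 1 U).sub_left
    ((commute_seed_spinMinus L h).smul_left _)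

end Seed

/-- If the pair field is a spin singlet then, for even `N ≤ 2L²`, the `S^z = 0` sector realises the `N`-sector minimum of the seeded canonical Hamiltonian `Hcan = hubbardTorus 2 L 1 U − (g/L²)Δ_dᴴΔ_d` (the `N`-sector ground eigenspace is stable under `S^±`, decomposes into integer `S^z`-weights, hence meets `S^z = 0`: `IsSu2Triple.su2_multiplet` (1)). -/
theorem stub_evenSectorMin :
    (∀ (φ : Literature.Probability.LatticeModels.Site 2 → ℝ) (L : ℕ) [NeZero L],
      Commute (pairField φ L) spinPlus ∧ Commute (pairField φ L) spinMinus) →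
    ∀ (L : ℕ) [NeZero L] (U g : ℝ) (N : ℕ), Even N → N ≤ 2 * L ^ 2 →
      (hubbardTorus 2 L 1 U - ((g / (L : ℝ) ^ 2 : ℝ) : ℂ) •
        ((pairField dWaveFormFactor L)ᴴ * pairField dWaveFormFactor L)).minEnergyOn
          (szSector (Λ := FermionTorus 2 L) N 0) =
      (hubbardTorus 2 L 1 U - ((g / (L : ℝ) ^ 2 : ℝ) : ℂ) •
        ((pairField dWaveFormFactor L)ᴴ * pairField dWaveFormFactor L)).minEnergyOn
          (nParticleSubmodule N) := by
  intro hsing L _ U g N hN hNle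
  classical
  obtain ⟨n, hn⟩ := hN
  obtain rfl : N = 2 * n := by omega
  -- the seeded canonical Hamiltonian and its symmetries
  have hHerm := isHermitian_hcan L U g
  have hPS := preservesSectors_hcan L U g
  have hHP := commute_hcan_spinPlus L U g (hsing dWaveFormFactor L)
  have hHM := commute_hcan_spinMinus L U g (hsing dWaveFormFactor L)
  set H := hubbardTorus 2 L 1 U - ((g / (L : ℝ) ^ 2 : ℝ) : ℂ) •
    ((pairField dWaveFormFactor L)ᴴ * pairField dWaveFormFactor L) with hHdef
  -- spectral theory in the `2n`-particle sector
  have hK : ∀ v, v ∈ nParticleSubmodule (ι := Orb (FermionTorus 2 L)) (2 * n) ↔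
      ∀ s, ¬ (s.card = 2 * n) → v s = 0 := fun v => Iff.rfl
  have hp : ∃ s : Finset (Orb (FermionTorus 2 L)), s.card = 2 * n := by
    have hle : 2 * n ≤ (Finset.univ : Finset (Orb (FermionTorus 2 L))).card := by
      rw [Finset.card_univ, card_orb]
      simpa [Fintype.card_lex, Fintype.card_fin] using hNle
    obtain ⟨s, -, hs⟩ := Finset.exists_subset_card_eq hle
    exact ⟨s, hs⟩
  have hinv : ∀ s s' : Finset (Orb (FermionTorus 2 L)), ¬ s.card = 2 * n → s'.card = 2 * n →
      H s s' = 0 := by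
    intro s s' hs hs'
    by_contra hne
    obtain ⟨h1, h2⟩ := hPS _ _ hne
    apply hs
    rw [card_eq_upPart_add_downPart, h1, h2, ← card_eq_upPart_add_downPart]
    exact hs'
  obtain ⟨⟨v₁, hv₁K, hv₁0, hv₁eq⟩, hvar⟩ := sector_groundState H hHerm (fun s => s.card = 2 * n)
    hp hinv (nParticleSubmodule (2 * n)) hK
  set E := H.minEnergyOn (nParticleSubmodule (2 * n)) with hEdef
  -- the ground sector `V = ker(H - E) ∩ {2n-particle vectors}` (no `DecidableEq`-dependent
  -- constants, so that generic-`Λ` lemmas apply verbatim on the fermionic torus)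
  set V : Submodule ℂ (Fock (Orb (FermionTorus 2 L))) :=
    Module.End.eigenspace (Matrix.mulVecLin H) (E : ℂ) ⊓ nParticleSubmodule (2 * n) with hVdef
  have hmemV : ∀ ψ, ψ ∈ V ↔ H *ᵥ ψ = (E : ℂ) • ψ ∧ IsNParticle (2 * n) ψ := fun ψ => by
    rw [hVdef, Submodule.mem_inf, Module.End.mem_eigenspace_iff, Matrix.mulVecLin_apply,
      mem_nParticleSubmodule_iff]
  have hv₁V : v₁ ∈ V := (hmemV v₁).2 ⟨hv₁eq, hv₁K⟩
  have hVne : V ≠ ⊥ := fun h => hv₁0 (by rw [h] at hv₁V; exact (Submodule.mem_bot ℂ).1 hv₁V)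
  -- `V` is stable under `S^±`
  have hPV : ∀ ψ ∈ V, spinPlus *ᵥ ψ ∈ V := by
    intro ψ hψ
    rw [hmemV] at hψ ⊢
    refine ⟨?_, LiebTwo.isNParticle_mulVec_of_commute hψ.2 LiebTwo.totalNumber_mul_spinPlus⟩
    rw [mulVec_mulVec, hHP.eq, ← mulVec_mulVec, hψ.1, mulVec_smul]
  have hMV : ∀ ψ ∈ V, spinMinus *ᵥ ψ ∈ V := by
    intro ψ hψ
    rw [hmemV] at hψ ⊢
    refine ⟨?_, LiebTwo.isNParticle_mulVec_of_commute hψ.2 LiebTwo.totalNumber_mul_spinMinus⟩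
    rw [mulVec_mulVec, hHM.eq, ← mulVec_mulVec, hψ.1, mulVec_smul]
  -- integer weight decomposition inside `V`
  have hwt : ∀ v ∈ V, ∃ (S : Finset ℤ) (w : ℤ → Fock (Orb (FermionTorus 2 L))),
      (∀ m ∈ S, w m ∈ V ∧ HubbardWave0.spinZ *ᵥ w m = (m : ℂ) • w m) ∧ v = ∑ m ∈ S, w m := by
    intro v hv
    obtain ⟨S, w, hw, hsum⟩ := weight_decomposition_of_preservesSectors hPS n E ((hmemV v).1 hv)
    exact ⟨S, w, fun m hm => ⟨(hmemV _).2 (hw m hm).1, (hw m hm).2⟩, hsum⟩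
  -- `su(2)`: `V` meets the weight-zero space
  obtain ⟨w, hwV, hw0, hwZ⟩ :=
    (IsSu2Triple.su2_multiplet LiebTwo.isSu2Triple_spin V hPV hMV hwt).1 hVne
  obtain ⟨a, -, ha1⟩ := exists_smul_unit hw0
  have hwV' := (hmemV w).1 hwV
  have hmemSz : a • w ∈ szSector (Λ := FermionTorus 2 L) (2 * n) 0 := by
    rw [mem_szSector_iff]
    refine ⟨fun s hs => ?_, ?_⟩
    · rw [Pi.smul_apply, hwV'.2 s hs, smul_zero]
    · rw [mulVec_smul, hwZ, smul_zero, Complex.ofReal_zero, zero_smul]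
  have hray : (star (a • w) ⬝ᵥ H *ᵥ (a • w)).re = E := by
    rw [mulVec_smul, hwV'.1, smul_comm, dotProduct_smul, ha1, smul_eq_mul, mul_one,
      Complex.ofReal_re]
  -- compare the two Rayleigh infima
  have hsub : ∀ ψ, ψ ∈ szSector (Λ := FermionTorus 2 L) (2 * n) 0 →
      ψ ∈ nParticleSubmodule (ι := Orb (FermionTorus 2 L)) (2 * n) :=
    fun ψ hψ => ((mem_szSector_iff _ _ ψ).1 hψ).1
  have hEmem : E ∈ {E' : ℝ | ∃ ψ ∈ szSector (Λ := FermionTorus 2 L) (2 * n) 0,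
      star ψ ⬝ᵥ ψ = 1 ∧ E' = (star ψ ⬝ᵥ H *ᵥ ψ).re} :=
    ⟨a • w, hmemSz, ha1, hray.symm⟩
  have hlow : ∀ E' ∈ {E' : ℝ | ∃ ψ ∈ szSector (Λ := FermionTorus 2 L) (2 * n) 0,
      star ψ ⬝ᵥ ψ = 1 ∧ E' = (star ψ ⬝ᵥ H *ᵥ ψ).re}, E ≤ E' := by
    rintro E' ⟨ψ, hψ, hψ1, rfl⟩
    exact hvar ψ (hsub ψ hψ) hψ1
  rw [Matrix.minEnergyOn]
  exact le_antisymm (csInf_le ⟨E, hlow⟩ hEmem) (le_csInf ⟨E, hEmem⟩ hlow)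

end

end Summit.HubbardSuperconductivity.HubbardSuperconductivity.Theorems.TwSeededEnsembleEquivalence.ExposedDensity
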